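import Literature.Probability.RandomPlanarGeometry.BrownianExcursionRestriction
import HarnessLib

/-!
# [LSW] p. 5 result 2 holds: the discharges of `eq_five_eighths_of_simple` and `eq_five_eighths_of_outer_simple`

Proof-only file (no definition, no named fact), after

* G. F. Lawler, O. Schramm, W. Werner, *Conformal restriction: the chordal case*, J. Amer.
  Math. Soc. **16** (2003) 917–955, arXiv:math/0209343 (**[LSW]**), p. 5 result 2: "the only
  measure `P_α` which is supported on simple curves is `P_{5/8}`" (made precise on p. 4: "when
  `α` is greater than `5/8`, it is not supported on simple paths", and by Cor. 8.6: no `P_α` for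
  `α < 5/8`), and §4 (p. 16), after Prop. 4.1: "We have just proved that the two-sided
  restriction measure `P_1` exists."

The named facts
`Literature.Probability.RandomPlanarGeometry.IsRestrictionMeasure.eq_five_eighths_of_simple`
(almost-everywhere reading), `…eq_five_eighths_of_outer_simple` (outer reading) and
`Literature.Probability.RandomPlanarGeometry.LawlerSchrammWerner2003` (chordal restriction +
simple curves ⇒ SLE_{8/3}) were reduced in the tree to the existence of SOME two-sided
restriction measure of exponent `1` (`…_of_exists_one`, file `OneSidedExcursionCloudInterior`:
`P⁺_β` for all `β > 0` as left-filled Poissonian clouds of hung `P_1`-samples with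
`P⁺_β{i ∈ int K} > 0`, the one-sided squeeze of `RestrictionMeasuresFiveEighthsOneSided`,
Cor. 8.6, Prop. 3.3, Thm. 6.1 — all proved). That existence is now a theorem of the tree
(`exists_isRestrictionMeasure_one_brownianQuad`, file `BrownianExcursionRestriction`: [LSW]
Prop. 4.1 for the excursion `W⁰ + i|(W¹, W², W³)|` of four independent canonical Brownian
motions, through the harmonic function `Im Φ_A(x + i|w|)/|w|` of `ExcursionRestrictionHarmonic`,
the stopped harmonic identity of `Process/BrownianVecHarmonic`, the exit identity, the polarity
of the axis and the transience of `|w|` (`Process/BrownianVecTransience`), and the law of the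
filling of a chordal path (`ExcursionPathInputs`, `ChordalPathFill`)). Hence the two
discharges below, each a one-line application (`LawlerSchrammWerner2003` itself is already the
closed theorem `LawlerSchrammWerner2003_brownianQuad` of `BrownianExcursionRestriction`).

## References

* [LSW] p. 4, p. 5 results 1–2; §4 Prop. 4.1 (p. 16); Cor. 8.6 (pp. 37–38).
  [LawlerSchrammWerner2003Restriction]
-/

noncomputable section

namespace Literature.Probability.RandomPlanarGeometry

/-- **[LSW] p. 5 result 2 holds (almost-everywhere reading)**: a two-sided restriction measure
of exponent `α` almost every sample of which is a chordal simple path has `α = 5/8`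
(`Literature.Probability.RandomPlanarGeometry.IsRestrictionMeasure.eq_five_eighths_of_simple`).
[cite: LawlerSchrammWerner2003Restriction, p. 5 result 2 (with p. 4 and Cor. 8.6)] -/
theorem IsRestrictionMeasure.eq_five_eighths_of_simple_holds :
    IsRestrictionMeasure.eq_five_eighths_of_simple :=
  IsRestrictionMeasure.eq_five_eighths_of_simple_of_exists_one exists_isRestrictionMeasure_one_brownianQuad

/-- **[LSW] p. 5 result 2 holds (outer reading)**: a two-sided restriction measure of exponent
`α` carried by an event of chordal simple paths has `α = 5/8`
(`Literature.Probability.RandomPlanarGeometry.IsRestrictionMeasure.eq_five_eighths_of_outer_simple`).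
[cite: LawlerSchrammWerner2003Restriction, p. 5 result 2 (with p. 4 and Cor. 8.6)] -/
theorem IsRestrictionMeasure.eq_five_eighths_of_outer_simple_holds :
    IsRestrictionMeasure.eq_five_eighths_of_outer_simple :=
  IsRestrictionMeasure.eq_five_eighths_of_outer_simple_of_exists_one
    exists_isRestrictionMeasure_one_brownianQuad

end Literature.Probability.RandomPlanarGeometry

end
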